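import Mathlib.Analysis.SpecialFunctions.Log.Basic
import Literature.NumberTheory.EllipticCurves.LangHeightEC
import HarnessLib

/-!
# The Szpiro ratio and Petsche's explicit form of Lang's height conjecture

Family `abc` (group G06 TranscendEllArithS), topic of `LangHeightEC.lean`. This file vendors the two
intermediate results through which "Szpiro ⇒ Lang's height lower bound over `ℚ`"
(`Literature.NumberTheory.EllipticCurves.szpiro_imp_langHeightLowerBoundConjecture`, Hindry–Silverman 1988, Thm. 0.3) is proved in
print with explicit constants, following

* C. Petsche, *Small rational points on elliptic curves over number fields*, New York J. Math.
  **12** (2006), 257–268 (arXiv `math/0508160`), Theorem 2 and Proposition 7,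

specialised to the ground field `k = ℚ` (`d = [k:ℚ] = 1`), which is all the `abc` route needs:

* `WeierstrassCurve.szpiroRatio A W` — the *Szpiro ratio*
  `σ = log N(𝔇_{E/K}) / log N(𝔣_{E/K})` of `E/K` (minimal discriminant over conductor), with
  Petsche's convention `σ = 1` when `E` has everywhere good reduction (Petsche 2006, (1), p. 257;
  Hindry–Silverman 1988, p. 420);
* `Literature.Petsche2006.c₁ = 134861`, `Literature.Petsche2006.c₂ = 104613`, the displayed bounds
  `Literature.Petsche2006.smallHeightBound d σ L = L / (2¹³·3·d·σ²)`,
  `Literature.Petsche2006.countBound d σ = c₁ d σ² log(c₂ d σ²)` and the constant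
  `Literature.Petsche2006.langConstant d σ = 1 / (10¹⁵ d³ σ⁶ log²(c₂ d σ²))` (Petsche 2006, (2), (5), (11));
* the named facts `Literature.NumberTheory.EllipticCurves.Petsche2006_card_smallPoints_le` (Proposition 7 over `ℚ`: at most
  `countBound 1 σ` rational points have `ĥ ≤ smallHeightBound 1 σ (log N(𝔇))`) and
  `Literature.NumberTheory.EllipticCurves.Petsche2006_langHeightLowerBound` (Theorem 2 over `ℚ`:
  `ĥ(P) ≥ langConstant 1 σ · log N(𝔇)` for non-torsion `P`), where Petsche's `ĥ(P)` is
  `P.canonicalHeight / 2` (see the normalisation note below).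

The sibling proof file `LangHeightECProofs.lean` proves Theorem 2 from Proposition 7 (Petsche's
half-page argument with the multiples `O, P, …, (M-1)P`) and
`Literature.NumberTheory.EllipticCurves.szpiro_imp_langHeightLowerBoundConjecture` from Theorem 2 (Szpiro's conjecture with one fixed
exponent bounds `σ` uniformly; cf. Silverman, AEC 2nd ed., Thm. VIII.9.10(b) and footnote 1,
pp. 218–219). Proposition 7 itself rests on the theory of Néron local heights (local decomposition
`ĥ = Σ_v (d_v/d) λ_v`, Tate-curve formulas, the archimedean estimates of Elkies and
Hindry–Silverman), which neither Mathlib nor `Literature/` has yet; it stays a named fact.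

## Design choices

* **Normalisation of `ĥ`.** `WeierstrassCurve.Affine.Point.canonicalHeight` (file `Heights.lean`) is
  `lim h_x(2ⁿP)/4ⁿ` *without* Silverman's factor `½`, whereas Petsche's `ĥ` is the one of
  Silverman's books (ATAEC Thm. VI.2.1: `ĥ = ½ h_x + O(1)`, local decomposition `ĥ = Σ_v (d_v/d) λ_v`),
  so over `ℚ` Petsche's `ĥ(P)` is `P.canonicalHeight / 2`. Both facts below are stated **exactly as
  printed**, with `P.canonicalHeight / 2` for Petsche's `ĥ(P)` and the printed constants; the forms
  with `canonicalHeight` itself follow by doubling the constants.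
* **Over `ℚ` only.** Mathlib's `Height.logHeight₁` on a number field `K` is the height relative to
  `K` (not divided by `[K:ℚ]`), so a faithful number-field version would need a further
  renormalisation; the route only needs `k = ℚ`, where all normalisations of `h` agree. The
  dimension parameter `d` is kept in the displayed bounds (instantiated at `d = 1`) so that the Lean
  formulas are literally Petsche's (2), (5), (11).
* **Szpiro ratio.** Defined for any Dedekind domain `A` with fraction field `K` and
  `[Module.Free ℤ A]` through `WeierstrassCurve.minimalDiscriminantNorm A` and
  `WeierstrassCurve.conductorNorm A` (files `MinimalDiscriminant`, `Conductor`), as a real number;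
  the case split is on `1 < W.conductorNorm A` ("`E` has a place of bad reduction": `f_v = 0 ↔`
  good reduction at `v`, `WeierstrassCurve.conductorExponent_eq_zero_iff`, and `N(𝔣) = 1 ↔ 𝔣 = ⊤`,
  `Ideal.absNorm_eq_one_iff`). For `A = ℤ` these are the quantities of `Literature.NumberTheory.EllipticCurves.SzpiroConjecture`.
* **Counting statement.** "`|S| ≤ B`" for the set `S` of small points is rendered as
  `S.Finite ∧ (S.ncard : ℝ) ≤ B` (finiteness is part of the printed assertion; it also follows from
  Northcott, `finite_setOf_canonicalHeight_le`).
* Statement-file rules of the group: `noncomputable section`, `open scoped Classical`, facts in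
  `namespace Literature`, the ratio as a deliberate dot-notation extension of Mathlib's `WeierstrassCurve`
  namespace (like `conductorNorm`, `minimalDiscriminantNorm`).
* Mathlib search: no `szpiro`, `Szpiro`, `Petsche`, `canonicalHeight` declarations in Mathlib (only
  docstring mentions of Szpiro in `Literature/`); nothing to reuse.

## References

* C. Petsche, *Small rational points on elliptic curves over number fields*, New York J. Math. 12
  (2006), 257–268; arXiv math/0508160. Theorem 2, Proposition 7, Lemmas 3–6.
* M. Hindry, J. H. Silverman, *The canonical height and integral points on elliptic curves*,
  Invent. Math. 93 (1988), 419–450, Theorem 0.3 (p. 420).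
* J. H. Silverman, *The Arithmetic of Elliptic Curves*, GTM 106, 2nd ed. (2009), Conjecture
  VIII.9.9, Theorem VIII.9.10(b) with footnote 1 (pp. 218–219), Conjecture VIII.11.1 (p. 221).
* J. H. Silverman, *Advanced Topics in the Arithmetic of Elliptic Curves*, GTM 151 (1994),
  Theorem VI.2.1 (local decomposition; normalisation of `ĥ`).
-/

noncomputable section

open scoped Classical

open IsDedekindDomain

/-! ### The Szpiro ratio -/

namespace WeierstrassCurve

section SzpiroRatio

variable (A : Type*) [CommRing A] [IsDedekindDomain A] [Module.Free ℤ A] {K : Type*} [Field K]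
  [Algebra A K] [IsFractionRing A K] (W : WeierstrassCurve K)

/-- The **Szpiro ratio** `σ_{E/K}` of a Weierstrass curve `W / K` with respect to the Dedekind domain
`A` (`A = ℤ` for `K = ℚ`, `A = 𝓞 K` for a number field): `σ = log N(𝔇_min) / log N(𝔣)`, the
logarithm of the norm of the minimal discriminant ideal over the logarithm of the norm of the
conductor, when `E` has at least one place of bad reduction (`N(𝔣) > 1`), and `σ = 1` by
convention when `E` has everywhere good reduction (`N(𝔣) = 1`). Petsche 2006, display (1) and the
sentence following it (p. 257); Hindry–Silverman 1988, p. 420 (`σ_{E/K}`).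
(Dot-notation extension of the Mathlib namespace `WeierstrassCurve`.) [cite: Petsche2006, (1)] -/
def szpiroRatio : ℝ :=
  if 1 < W.conductorNorm A then
    Real.log (W.minimalDiscriminantNorm A : ℝ) / Real.log (W.conductorNorm A : ℝ)
  else 1

/-- Unfolding lemma: if `E` has a place of bad reduction (`N(𝔣) > 1`), the Szpiro ratio is
`log N(𝔇_min) / log N(𝔣)`. Petsche 2006, (1). [cite: Petsche2006, (1)] -/
theorem szpiroRatio_of_one_lt_conductorNorm (h : 1 < W.conductorNorm A) :
    W.szpiroRatio A =
      Real.log (W.minimalDiscriminantNorm A : ℝ) / Real.log (W.conductorNorm A : ℝ) := by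
  rw [szpiroRatio, if_pos h]

/-- Unfolding lemma: if `E` has everywhere good reduction (`N(𝔣) ≤ 1`, i.e. `N(𝔣) = 1`), the Szpiro
ratio is `1` by convention. Petsche 2006, sentence after (1). [cite: Petsche2006, (1)] -/
theorem szpiroRatio_of_conductorNorm_le_one (h : W.conductorNorm A ≤ 1) : W.szpiroRatio A = 1 := by
  rw [szpiroRatio, if_neg (not_lt.mpr h)]

end SzpiroRatio

end WeierstrassCurve

/-! ### Petsche's constants and bounds -/

namespace Literature.NumberTheory.EllipticCurves

namespace Petsche2006

/-- Petsche's constant `c₁ = 134861` (Petsche 2006, Theorem 1 and Proposition 7).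
[cite: Petsche2006, Thm. 1] -/
def c₁ : ℝ := 134861

/-- Petsche's constant `c₂ = 104613` (Petsche 2006, Theorems 1, 2 and Proposition 7).
[cite: Petsche2006, Thm. 1] -/
def c₂ : ℝ := 104613

/-- The height threshold of Petsche 2006, Proposition 7, display (11): a point `P ∈ E(k)` is
*small* if `ĥ(P) ≤ log |N_{k/ℚ}(Δ_{E/k})| / (2¹³ · 3 · d · σ²)`, where `d = [k:ℚ]`, `σ` is the
Szpiro ratio and `L = log |N_{k/ℚ}(Δ_{E/k})|`. [cite: Petsche2006, Prop. 7] -/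
def smallHeightBound (d σ L : ℝ) : ℝ :=
  L / (2 ^ 13 * 3 * d * σ ^ 2)

/-- The counting bound of Petsche 2006, Theorem 1 / Proposition 7, displays (2) and (11):
`c₁ d σ² log(c₂ d σ²)`. [cite: Petsche2006, Prop. 7] -/
def countBound (d σ : ℝ) : ℝ :=
  c₁ * d * σ ^ 2 * Real.log (c₂ * d * σ ^ 2)

/-- The constant of Petsche 2006, Theorem 2, display (5):
`c(d, σ) = 1 / (10¹⁵ d³ σ⁶ log²(c₂ d σ²))`. [cite: Petsche2006, Thm. 2, (5)] -/
def langConstant (d σ : ℝ) : ℝ :=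
  1 / (10 ^ 15 * d ^ 3 * σ ^ 6 * Real.log (c₂ * d * σ ^ 2) ^ 2)

/-- Unfolding lemma for `smallHeightBound`. [folklore] -/
theorem smallHeightBound_def (d σ L : ℝ) :
    smallHeightBound d σ L = L / (2 ^ 13 * 3 * d * σ ^ 2) := rfl

/-- Unfolding lemma for `countBound`. [folklore] -/
theorem countBound_def (d σ : ℝ) : countBound d σ = c₁ * d * σ ^ 2 * Real.log (c₂ * d * σ ^ 2) :=
  rfl

/-- Unfolding lemma for `langConstant`. [folklore] -/
theorem langConstant_def (d σ : ℝ) :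
    langConstant d σ = 1 / (10 ^ 15 * d ^ 3 * σ ^ 6 * Real.log (c₂ * d * σ ^ 2) ^ 2) := rfl

/-- `c(d, σ) ≥ 0` for all real `d ≥ 0`, `σ` (the denominator is a product of a square, an even
power, `d³ ≥ 0` and `10¹⁵`; Lean's `1 / 0 = 0` covers the degenerate case). [folklore] -/
theorem langConstant_nonneg {d : ℝ} (hd : 0 ≤ d) (σ : ℝ) : 0 ≤ langConstant d σ := by
  unfold langConstant
  positivity

end Petsche2006

/-! ### The two named facts (Petsche 2006, Proposition 7 and Theorem 2, over `ℚ`) -/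

/-- **Petsche 2006, Proposition 7** (p. 263), ground field `k = ℚ` (`d = 1`): *Let `k` be a number
field of degree `d = [k:ℚ]`, and let `E/k` be an elliptic curve with Szpiro ratio `σ`. Then
`|{P ∈ E(k) | ĥ(P) ≤ log |N_{k/ℚ}(Δ_{E/k})| / (2¹³ 3 d σ²)}| ≤ c₁ d σ² log(c₂ d σ²)`, where
`c₁ = 134861` and `c₂ = 104613`.* Here `E/ℚ` is any Weierstrass equation `W` of the curve
(`N(Δ_{E/ℚ}) = W.minimalDiscriminantNorm ℤ` and `σ = W.szpiroRatio ℤ` are isomorphism invariants),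
Petsche's `ĥ(P)` (Silverman's normalisation) is `P.canonicalHeight / 2`, and "`|S| ≤ B`" is written
as `S.Finite ∧ S.ncard ≤ B`. The printed proof (pp. 263–265) combines the local decomposition of `ĥ`
into Néron local heights with Lemmas 3–6 of the paper. [cite: Petsche2006, Prop. 7] -/
def Petsche2006_card_smallPoints_le : Prop :=
  ∀ (W : WeierstrassCurve ℚ) [W.IsElliptic],
    {P : W.toAffine.Point | P.canonicalHeight / 2 ≤
        Petsche2006.smallHeightBound 1 (W.szpiroRatio ℤ)
          (Real.log (W.minimalDiscriminantNorm ℤ : ℝ))}.Finite ∧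
      (({P : W.toAffine.Point | P.canonicalHeight / 2 ≤
          Petsche2006.smallHeightBound 1 (W.szpiroRatio ℤ)
            (Real.log (W.minimalDiscriminantNorm ℤ : ℝ))}.ncard : ℝ) ≤
        Petsche2006.countBound 1 (W.szpiroRatio ℤ))

/-- **Petsche 2006, Theorem 2** (p. 258), ground field `k = ℚ` (`d = 1`): *Let `k` be a number
field of degree `d = [k:ℚ]`, and let `E/k` be an elliptic curve with minimal discriminant `Δ_{E/k}`
and Szpiro ratio `σ`. Then `ĥ(P) ≥ c(d, σ) log |N_{k/ℚ}(Δ_{E/k})|` for all non-torsion points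
`P ∈ E(k)`, where `c(d, σ) = 1 / (10¹⁵ d³ σ⁶ log²(c₂ d σ²))` and `c₂ = 104613`.* Petsche, loc. cit.:
"A consequence of Theorem 2 is that Szpiro's conjecture implies Lang's conjecture; this fact was
originally proved by Hindry–Silverman [Invent. Math. 93 (1988)]". As for Proposition 7, `W` is any
Weierstrass equation of `E/ℚ`, `N(Δ_{E/ℚ}) = W.minimalDiscriminantNorm ℤ`, `σ = W.szpiroRatio ℤ`,
and Petsche's `ĥ(P)` (Silverman's normalisation) is `P.canonicalHeight / 2`. Proved from
`Petsche2006_card_smallPoints_le` in `LangHeightECProofs.lean`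
(`Petsche2006_langHeightLowerBound_of_card_smallPoints_le`), as in the paper (p. 265).
[cite: Petsche2006, Thm. 2] -/
def Petsche2006_langHeightLowerBound : Prop :=
  ∀ (W : WeierstrassCurve ℚ) [W.IsElliptic] (P : W.toAffine.Point), ¬ IsOfFinAddOrder P →
    Petsche2006.langConstant 1 (W.szpiroRatio ℤ) * Real.log (W.minimalDiscriminantNorm ℤ : ℝ) ≤
      P.canonicalHeight / 2

end Literature.NumberTheory.EllipticCurves

end
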